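import Literature.NumberTheory.GaloisRepresentations.InertiaCohomologyFinite
import HarnessLib

/-!
# `#H¹(I_F, B) ≤ #B^{I_F}`: the sharp bound for the cohomology of the inertia group with finite
# coefficients of order prime to the residue characteristic (theorems only)

Topic `NumberTheory/GaloisRepresentations`; namespace `Literature.NumberTheory.GaloisRepresentations`.
THEOREMS ONLY (no definition, no named fact; D-0026). Sequel of `InertiaCohomologyFinite`
(`natCard_continuousCohomology_one_absInertia_le`: `#H¹(I_F, B) ≤ #B`).

Let `F` be a non-archimedean local field with residue characteristic `p`, `I_F = absInertia F` its
inertia group and `B` a finite discrete `Γ_F`-module of order prime to `p`. The tame structure of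
`I_F` (the wild subgroup `I_p` is pro-`p`, the tame quotient `I_F/I_p ≅ ∏_{ℓ ≠ p} ℤ_ℓ(1)` is
procyclic) gives `H¹(I_F, B) ≅ H¹(I_F/I_p, B^{I_p}) ≅ (B^{I_p})_{τ}` for a topological generator `τ`
of the tame quotient (Harari, *Galois Cohomology and Class Field Theory*, proof of Lemma 10.13;
Milne, *ADT*, proof of I Thm. 2.8; Serre, *Local Fields*, XIII §1 Prop. 1 and IV §2), whence the
ORDER of `H¹(I_F, B)` is the order of the `τ`-invariants of `B^{I_p}`, i.e. of `B^{I_F}`. This file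
proves the inequality that the tree's consumers need,

* `natCard_continuousCohomology_one_absInertia_le_natCard_invariants` —
  **`#H¹(I_F, B) ≤ #B^{I_F}`** (`B^{I_F} = {b : ∀ σ ∈ I_F, σ b = b}`),

by sharpening the finite-quotient argument of `InertiaCohomologyFinite`: all (finitely many)
classes are represented by crossed homomorphisms `ψ` vanishing on `W = K ∩ I_F` for ONE open normal
`K ⊴ Γ_F` with `I_F/W = ⟨ḡ⟩` cyclic (`exists_normal_forall_eq_coboundary`, the key step of loc. cit.
with the normality of `K` recorded); then `ψ(g)` lies in `B^W`, the class of `ψ(g)` in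
`B^W/(g - 1)B^W` determines the cohomology class, and `#(B^W/(g - 1)B^W) = #(B^W)^{g} = #B^{I_F}`.

Consumers (cell `b2b-bsdres`, Greenberg–Vatsal §2 Prop. (2.4) in the kernel): for `B = E[pⁿ]` at a
place `v ∤ p` of bad reduction, `#H¹(I_v, E[pⁿ]) ≤ #E[pⁿ]^{I_v}` bounds the corank of
`H¹(I_v, E[p^∞])` by the corank of `E[p^∞]^{I_v}` (`0` at an additive place, `1` at a multiplicative
one).

## References

* [SerreLocalFields1979] J.-P. Serre, *Local Fields*, GTM 67 (1979), Ch. IV §2 Cor. 1 and Cor. 3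
  of Prop. 7 (tame quotient cyclic of order prime to `p`, `G_1` a `p`-group), Ch. XIII §1 Prop. 1
  (cohomology of a procyclic group: `H¹ = ` coinvariants).
* [MilneADT2006] J. S. Milne, *Arithmetic Duality Theorems*, 2nd ed. (2006), I §2 Lemma 2.9 and
  the proof of Thm. 2.8.
* D. Harari, *Galois Cohomology and Class Field Theory* (2020), Lemma 10.13 and the proof of
  Prop. 10.12.
-/

noncomputable section

open CategoryTheory Function
open scoped Pointwise Valued
open Field ValuativeRel

universe u

namespace Literature.NumberTheory.GaloisRepresentations

open _root_.TopRep _root_.ContinuousCohomology _root_.Topology _root_.Filter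
open GaloisRepresentations.IsNonarchimedeanLocalField

section Local

variable (F : Type u) [Field F] [ValuativeRel F] [TopologicalSpace F] [IsNonarchimedeanLocalField F]

variable {B : Type u} [AddCommGroup B] [TopologicalSpace B] [DiscreteTopology B] [Finite B]

/-- Uniform local constancy on the compact group `I_F`: a finite family of continuous crossed
homomorphisms `I_F → B` is right-invariant under `I_F ∩ V` for some open normal `V ⊴ Γ_F` acting
trivially on `B` (private; the first step of `InertiaCohomologyFinite.exists_subgroup_forall_eq_coboundary`,
isolated). [folklore] -/
private theorem exists_openNormal_trivial_rightInvariant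
    (ρ : ContinuousRep (absoluteGaloisGroup F) ℤ B)
    (s : Finset (contOneCocycles ((ρ.restrict (subgroupIncl (absInertia F))).toTopRep))) :
    ∃ V : Subgroup (absoluteGaloisGroup F), V.Normal ∧
      IsOpen (V : Set (absoluteGaloisGroup F)) ∧ (∀ v ∈ V, ∀ b : B, ρ v b = b) ∧
      ∀ φ ∈ s, ∀ (x y : absInertia F), (y : absoluteGaloisGroup F) ∈ V → φ.1 (x * y) = φ.1 x := by
  classical
  haveI : CompactSpace (absoluteGaloisGroup F) := absoluteGaloisGroup_compactSpace F
  have hIcl : IsClosed (absInertia F : Set (absoluteGaloisGroup F)) := isClosed_absInertia_holds F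
  haveI : CompactSpace (absInertia F) := isCompact_iff_compactSpace.mp hIcl.isCompact
  haveI : Fintype B := Fintype.ofFinite B
  have hker : IsOpen {g : absoluteGaloisGroup F | ∀ b : B, ρ g b = b} := by
    have : {g : absoluteGaloisGroup F | ∀ b : B, ρ g b = b} = ⋂ b : B, (fun g => ρ g b) ⁻¹' {b} := by
      ext g; simp
    rw [this]
    exact isOpen_iInter_of_finite fun b => (isOpen_discrete _).preimage (ρ.continuous_apply_left b)
  obtain ⟨V₁, hV₁⟩ := ProfiniteGrp.exist_openNormalSubgroup_sub_open_nhds_of_one hker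
    (fun b => by rw [map_one]; rfl)
  -- uniform local constancy of the family on `I`
  let Φ : absInertia F → (s → B) := fun x φ =>
    (show C(absInertia F, B) from
      ((φ : contOneCocycles ((ρ.restrict (subgroupIncl (absInertia F))).toTopRep)).1)) x
  have hΦ : IsLocallyConstant Φ :=
    (IsLocallyConstant.iff_continuous Φ).2 (continuous_pi fun φ =>
      (show C(absInertia F, B) from
        ((φ : contOneCocycles ((ρ.restrict (subgroupIncl (absInertia F))).toTopRep)).1)).continuous)
  -- a locally constant function on a compact group is right-invariant under a neighbourhood of `1`
  have hunif : ∃ U ∈ 𝓝 (1 : absInertia F), ∀ g, ∀ u ∈ U, Φ (g * u) = Φ g := by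
    have hfib : ∀ y : s → B, ∃ U ∈ 𝓝 (1 : absInertia F), Φ ⁻¹' {y} * U ⊆ Φ ⁻¹' {y} := fun y =>
      compact_open_separated_mul_right (hΦ.isClosed_fiber y).isCompact (hΦ.isOpen_fiber y) subset_rfl
    choose U hU hUsub using hfib
    have hfin : (Set.range Φ).Finite := hΦ.range_finite
    refine ⟨⋂ y ∈ hfin.toFinset, U y, (Filter.biInter_finset_mem _).2 fun y _ => hU y,
      fun g u hu => ?_⟩
    have huy : u ∈ U (Φ g) :=
      Set.mem_iInter₂.1 hu (Φ g) (by rw [Set.Finite.mem_toFinset]; exact ⟨g, rfl⟩)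
    exact hUsub (Φ g) (Set.mul_mem_mul rfl huy)
  obtain ⟨U, hU, hUΦ⟩ := hunif
  rw [nhds_subtype_eq_comap, Filter.mem_comap] at hU
  obtain ⟨U', hU', hU'U⟩ := hU
  obtain ⟨V₂, hV₂⟩ := ProfiniteGrp.exist_openNormalSubgroup_sub_open_nhds_of_one isOpen_interior
    (mem_interior_iff_mem_nhds.2 hU')
  refine ⟨(V₁ : Subgroup (absoluteGaloisGroup F)) ⊓ (V₂ : Subgroup (absoluteGaloisGroup F)),
    inferInstance, V₁.isOpen.inter V₂.isOpen, fun v hv b => hV₁ hv.1 b, fun φ hφ x y hy => ?_⟩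
  have hyU : y ∈ U := hU'U (show (y : absoluteGaloisGroup F) ∈ U' from interior_subset (hV₂ hy.2))
  exact congr_fun (hUΦ x y hyU) ⟨φ, hφ⟩

/-- **Key step, with the normality of the level recorded.** For a finite family `s` of continuous
crossed homomorphisms `I_F → B` (`#B` prime to the residue characteristic) there are an open
NORMAL subgroup `K ⊴ Γ_F` and `g ∈ I_F` such that `I_F = ⋃ₖ gᵏ (K ∩ I_F)` (the tame quotient
`I_F/(K ∩ I_F)` is cyclic, generated by `g`) and every `φ ∈ s` is a coboundary on `K ∩ I_F`. This
is `InertiaCohomologyFinite.exists_subgroup_forall_eq_coboundary` (there `W = K ∩ I_F` is returned as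
a bare subgroup of `I_F`); the same proof: `K = I_F^{v₁} · V` with `V ⊴ Γ_F` open acting trivially,
`I_F^{v₁}` having `p`-group image in `Γ_F/V` (averaging trick), and `I_F/(K ∩ I_F)` cyclic because
`Γ_F → Γ_F/K` kills every `I_F^v`, `v > 0`.
[cite: SerreLocalFields1979, IV §2 Cor. 1 and Cor. 3 of Prop. 7] -/
theorem exists_normal_forall_eq_coboundary (ρ : ContinuousRep (absoluteGaloisGroup F) ℤ B)
    (hB : (Nat.card B).Coprime (ringChar 𝓀[F]))
    (s : Finset (contOneCocycles ((ρ.restrict (subgroupIncl (absInertia F))).toTopRep))) :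
    ∃ (K : Subgroup (absoluteGaloisGroup F)) (_ : K.Normal) (g : absInertia F),
      (∀ x : absInertia F, ∃ k : ℕ,
        (((g ^ k)⁻¹ * x : absInertia F) : absoluteGaloisGroup F) ∈ K) ∧
      ∀ φ ∈ s, ∃ b : B, ∀ w : absInertia F, (w : absoluteGaloisGroup F) ∈ K →
        φ.1 w = ρ (w : absoluteGaloisGroup F) b - b := by
  classical
  haveI : CompactSpace (absoluteGaloisGroup F) := absoluteGaloisGroup_compactSpace F
  haveI : Fact (ringChar 𝓀[F]).Prime := ⟨ringChar_residueField_prime (F := F)⟩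
  -- Step 1: an open normal `V` acting trivially, with all `φ ∈ s` right `I ∩ V`-invariant
  obtain ⟨V, hVnormal, hVopen, hVact, hVinv⟩ := exists_openNormal_trivial_rightInvariant F ρ s
  haveI := hVnormal
  haveI : Finite (absoluteGaloisGroup F ⧸ V) := Subgroup.quotient_finite_of_isOpen V hVopen
  haveI : DiscreteTopology (absoluteGaloisGroup F ⧸ V) := QuotientGroup.discreteTopology hVopen
  let π : absoluteGaloisGroup F →ₜ* (absoluteGaloisGroup F ⧸ V) :=
    ⟨QuotientGroup.mk' V, QuotientGroup.continuous_mk⟩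
  -- Step 2: the images of `I^v` in `Γ/V` stabilise near `0`
  let Pv : ℝ → Subgroup (absoluteGaloisGroup F ⧸ V) := fun v => (absUpperInertia F v).map π.toMonoidHom
  have hanti : ∀ {v v'}, v ≤ v' → Pv v' ≤ Pv v := fun h =>
    Subgroup.map_mono (absUpperInertia_antitone_holds F h)
  obtain ⟨v₁, hv₁, hstab⟩ : ∃ v₁ : ℝ, 0 < v₁ ∧ ∀ v, 0 < v → v ≤ v₁ → Pv v = Pv v₁ := by
    let a : ℕ →o Subgroup (absoluteGaloisGroup F ⧸ V) := ⟨fun n => Pv (1 / (n + 1)), fun m n hmn =>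
      hanti (by
        apply one_div_le_one_div_of_le (by positivity); exact_mod_cast Nat.succ_le_succ hmn)⟩
    obtain ⟨n₀, hn₀⟩ := WellFoundedGT.monotone_chain_condition a
    refine ⟨1 / (n₀ + 1), by positivity, fun v hv hle => le_antisymm ?_ (hanti hle)⟩
    obtain ⟨n, hn⟩ := exists_nat_one_div_lt hv
    have h1 : (1 : ℝ) / ((max n n₀ : ℕ) + 1) ≤ v := by
      refine le_trans ?_ hn.le
      apply one_div_le_one_div_of_le (by positivity)
      exact_mod_cast Nat.succ_le_succ (le_max_left n n₀)
    calc Pv v ≤ Pv (1 / ((max n n₀ : ℕ) + 1)) := hanti h1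
      _ = a (max n n₀) := rfl
      _ = a n₀ := (hn₀ _ (le_max_right _ _)).symm
      _ = Pv (1 / (n₀ + 1)) := rfl
  -- Step 3: `K = I^{v₁} V`, open normal, kills every `I^v`
  set J : Subgroup (absoluteGaloisGroup F) := absUpperInertia F v₁ with hJdef
  haveI : J.Normal := absUpperInertia_normal F v₁
  have hJI : J ≤ absInertia F := absUpperInertia_le_absInertia_holds F v₁
  set K : Subgroup (absoluteGaloisGroup F) := J ⊔ V with hKdef
  haveI hKnormal : K.Normal := Subgroup.sup_normal J V
  have hVK : V ≤ K := le_sup_right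
  have hKopen : IsOpen (K : Set (absoluteGaloisGroup F)) := Subgroup.isOpen_mono hVK hVopen
  haveI : DiscreteTopology (absoluteGaloisGroup F ⧸ K) := QuotientGroup.discreteTopology hKopen
  haveI : Finite (absoluteGaloisGroup F ⧸ K) := Subgroup.quotient_finite_of_isOpen K hKopen
  let f : absoluteGaloisGroup F →ₜ* (absoluteGaloisGroup F ⧸ K) :=
    ⟨QuotientGroup.mk' K, QuotientGroup.continuous_mk⟩
  have hkill : ∀ v : ℝ, 0 < v → ∀ σ ∈ absUpperInertia F v, f σ = 1 := by
    intro v hv σ hσ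
    change QuotientGroup.mk' K σ = 1
    rw [QuotientGroup.mk'_apply, QuotientGroup.eq_one_iff]
    rcases le_total v v₁ with hle | hle
    · have hmem : π.toMonoidHom σ ∈ Pv v₁ := hstab v hv hle ▸ Subgroup.mem_map_of_mem _ hσ
      obtain ⟨y, hy, hyσ⟩ := Subgroup.mem_map.1 hmem
      have hyσ' : y⁻¹ * σ ∈ V := by
        change QuotientGroup.mk' V y = QuotientGroup.mk' V σ at hyσ
        rwa [QuotientGroup.mk'_apply, QuotientGroup.mk'_apply, QuotientGroup.eq] at hyσ
      rw [show σ = y * (y⁻¹ * σ) by group]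
      exact K.mul_mem (le_sup_left (b := V) hy) (hVK hyσ')
    · exact le_sup_left (b := V) (absUpperInertia_antitone_holds F hle hσ)
  obtain ⟨hcyc, -⟩ := absInertia_map_isCyclic_holds F (absoluteGaloisGroup F ⧸ K) f hkill
  -- Step 4: a generator of the cyclic image of `I`
  obtain ⟨c, hc⟩ := @IsCyclic.exists_generator _ _ hcyc
  obtain ⟨g₀, hg₀, hg₀c⟩ := Subgroup.mem_map.1 c.2
  refine ⟨K, hKnormal, ⟨g₀, hg₀⟩, fun x => ?_, fun φ hφ => ?_⟩
  · have hx : (⟨f.toMonoidHom x, Subgroup.mem_map_of_mem _ x.2⟩ : (absInertia F).map f.toMonoidHom) ∈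
        Submonoid.powers c := by
      rw [(isOfFinOrder_of_finite c).mem_powers_iff_mem_zpowers]; exact hc _
    obtain ⟨k, hk⟩ := (Submonoid.mem_powers_iff _ _).1 hx
    refine ⟨k, ?_⟩
    have hk' : f.toMonoidHom (g₀ ^ k) = f.toMonoidHom x := by
      have := congrArg Subtype.val hk
      rw [SubmonoidClass.coe_pow, ← hg₀c, ← map_pow] at this
      exact this
    rw [Subgroup.coe_mul, Subgroup.coe_inv, SubgroupClass.coe_pow]
    change QuotientGroup.mk' K (g₀ ^ k) = QuotientGroup.mk' K (x : absoluteGaloisGroup F) at hk'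
    rwa [QuotientGroup.mk'_apply, QuotientGroup.mk'_apply, QuotientGroup.eq] at hk'
  · -- Step 5: averaging on `J = I^{v₁}`
    have hPJ : IsPGroup (ringChar 𝓀[F]) (J.map (QuotientGroup.mk' V)) :=
      absUpperInertia_map_isPGroup_holds F (absoluteGaloisGroup F ⧸ V) π hv₁
    let ψ : J → B := fun y => φ.1 ⟨y, hJI y.2⟩
    obtain ⟨b, hb⟩ := exists_forall_eq_coboundary_of_isPGroup ρ hB J V hPJ ψ
      (fun x y => φ.2 ⟨x, hJI x.2⟩ ⟨y, hJI y.2⟩)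
      (fun x y hy => hVinv φ hφ ⟨x, hJI x.2⟩ ⟨y, hJI y.2⟩ ((QuotientGroup.eq_one_iff _).1 hy))
    refine ⟨b, fun w hw => ?_⟩
    -- `w = y v` with `y ∈ J`, `v ∈ V`
    have hw' : ((w : absoluteGaloisGroup F)) ∈ (↑(J ⊔ V) : Set (absoluteGaloisGroup F)) := hw
    rw [Subgroup.normal_mul] at hw'
    obtain ⟨y, hy, v, hv, hyv⟩ := Set.mem_mul.1 hw'
    have hvI : v ∈ absInertia F := by
      have : v = y⁻¹ * w := by rw [← hyv, inv_mul_cancel_left]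
      rw [this]; exact (absInertia F).mul_mem ((absInertia F).inv_mem (hJI hy)) w.2
    have hwprod : w = ⟨y, hJI hy⟩ * ⟨v, hvI⟩ := Subtype.ext hyv.symm
    rw [hwprod, hVinv φ hφ _ _ hv]
    change ψ ⟨y, hy⟩ = ρ (y * v) b - b
    rw [hb ⟨y, hy⟩, map_mul, Module.End.mul_apply, hVact v hv]

/-- **`#H¹(I_F, B) ≤ #B^{I_F}`** — the order of the first cohomology group of the inertia group
`I_F` of a non-archimedean local field with coefficients in a finite discrete `Γ_F`-module `B` of
order prime to the residue characteristic is at most the order of the `I_F`-invariants of `B`.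
(Classically an equality: `H¹(I_F, B) ≅ H¹(I_F/I_p, B^{I_p}) ≅ (B^{I_p})_τ` for a topological
generator `τ` of the procyclic tame quotient, and `#(B^{I_p})_τ = #(B^{I_p})^τ = #B^{I_F}`; Harari,
proof of Lemma 10.13; Milne, proof of I Thm. 2.8; Serre, *Local Fields* XIII §1 Prop. 1.)
Proof: with `K ⊴ Γ_F`, `g` as in `exists_normal_forall_eq_coboundary` for representatives of ALL
classes, each class is represented by a crossed homomorphism `ψ` vanishing on `W = K ∩ I_F`; then
`ψ(g) ∈ B^W` (as `wg = g(g⁻¹wg)`), and `[ψ] ↦ ψ(g) mod (g - 1)B^W` is injective (a crossed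
homomorphism vanishing on `W` and at `g` vanishes on `I_F = ⋃ gᵏ W`), while
`#(B^W/(g - 1)B^W) = #ker(g - 1 | B^W) = #B^{I_F}`.
[cite: SerreLocalFields1979, Ch. XIII §1 Prop. 1 and Ch. IV §2 Cor. 1, Cor. 3 of Prop. 7]
[cite: MilneADT2006, I §2 Lemma 2.9 and proof of Thm. 2.8] -/
theorem natCard_continuousCohomology_one_absInertia_le_natCard_invariants
    (ρ : ContinuousRep (absoluteGaloisGroup F) ℤ B) (hB : (Nat.card B).Coprime (ringChar 𝓀[F])) :
    Nat.card (continuousCohomology 1 ((ρ.restrict (subgroupIncl (absInertia F))).toTopRep)) ≤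
      Nat.card {b : B // ∀ σ : absoluteGaloisGroup F, σ ∈ absInertia F → ρ σ b = b} := by
  classical
  haveI : Fintype B := Fintype.ofFinite B
  haveI hfin : Finite (continuousCohomology 1 ((ρ.restrict (subgroupIncl (absInertia F))).toTopRep)) :=
    (natCard_continuousCohomology_one_absInertia_le F ρ hB).1
  haveI := Fintype.ofFinite (continuousCohomology 1 ((ρ.restrict (subgroupIncl (absInertia F))).toTopRep))
  -- representatives of all classes, and the level `K`, generator `g`, primitives `b c`
  choose rep hrep using fun c : continuousCohomology 1 ((ρ.restrict (subgroupIncl (absInertia F))).toTopRep) =>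
    oneCocycleClass_surjective _ c
  obtain ⟨K, hKnormal, g, hgen, hcob⟩ :=
    exists_normal_forall_eq_coboundary F ρ hB (Finset.univ.image rep)
  haveI := hKnormal
  choose b hb using fun c : continuousCohomology 1 ((ρ.restrict (subgroupIncl (absInertia F))).toTopRep) =>
    hcob (rep c) (Finset.mem_image_of_mem rep (Finset.mem_univ c))
  -- the `W`-invariants `BK = B^{K ∩ I_F}`, stable under `g`
  let BK : AddSubgroup B :=
    { carrier := {x | ∀ w : absInertia F, (w : absoluteGaloisGroup F) ∈ K →
        ρ (w : absoluteGaloisGroup F) x = x}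
      zero_mem' := fun w _ => map_zero _
      add_mem' := fun {x y} hx hy w hw => by rw [map_add, hx w hw, hy w hw]
      neg_mem' := fun {x} hx w hw => by rw [map_neg, hx w hw] }
  have hBKmem : ∀ x : B, x ∈ BK ↔ ∀ w : absInertia F, (w : absoluteGaloisGroup F) ∈ K →
      ρ (w : absoluteGaloisGroup F) x = x := fun x => Iff.rfl
  have hconjK : ∀ w : absInertia F, (w : absoluteGaloisGroup F) ∈ K →
      (((g⁻¹ * w * g : absInertia F)) : absoluteGaloisGroup F) ∈ K := fun w hw => by
    have := hKnormal.conj_mem _ hw (g : absoluteGaloisGroup F)⁻¹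
    rw [inv_inv] at this
    simpa [Subgroup.coe_mul, mul_assoc] using this
  have hgBK : ∀ x ∈ BK, ρ (g : absoluteGaloisGroup F) x ∈ BK := fun x hx w hw => by
    have h1 : ((w : absoluteGaloisGroup F)) * (g : absoluteGaloisGroup F) =
        (g : absoluteGaloisGroup F) * (((g⁻¹ * w * g : absInertia F)) : absoluteGaloisGroup F) := by
      simp [Subgroup.coe_mul, mul_assoc]
    rw [← Module.End.mul_apply, ← map_mul, h1, map_mul, Module.End.mul_apply,
      hx _ (hconjK w hw)]
  -- `T = (g - 1)` on `BK`
  let T : BK →+ BK :=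
    { toFun := fun x => ⟨ρ (g : absoluteGaloisGroup F) x - x, BK.sub_mem (hgBK x x.2) x.2⟩
      map_zero' := Subtype.ext (by simp)
      map_add' := fun x y => Subtype.ext (by
        simp only [AddSubgroup.coe_add, map_add, AddMemClass.mk_add_mk]; abel) }
  have hT : ∀ x : BK, ((T x : BK) : B) = ρ (g : absoluteGaloisGroup F) x - x := fun _ => rfl
  -- every element of `I_F` is `gᵏ w` with `w ∈ K`; the `g`-fixed points of `BK` are `B^{I_F}`
  have hfix_iff : ∀ x : B, (∀ σ : absoluteGaloisGroup F, σ ∈ absInertia F → ρ σ x = x) ↔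
      (x ∈ BK ∧ ρ (g : absoluteGaloisGroup F) x = x) := by
    intro x
    refine ⟨fun h => ⟨fun w _ => h _ w.2, h _ g.2⟩, fun ⟨hxK, hxg⟩ σ hσ => ?_⟩
    obtain ⟨k, hk⟩ := hgen ⟨σ, hσ⟩
    have hpow : ∀ n : ℕ, ρ ((g : absoluteGaloisGroup F) ^ n) x = x := fun n => by
      induction n with
      | zero => rw [pow_zero, map_one]; rfl
      | succ n ih => rw [pow_succ, map_mul, Module.End.mul_apply, hxg, ih]
    have hw := hxK _ hk
    have heq : σ = (g : absoluteGaloisGroup F) ^ k *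
        ((((g ^ k)⁻¹ * ⟨σ, hσ⟩ : absInertia F)) : absoluteGaloisGroup F) := by
      simp [Subgroup.coe_mul]
    rw [heq, map_mul, Module.End.mul_apply, hw, hpow]
  -- the normalised representative `D c = rep c - ∂(b c)` and its value at `g`
  let D : continuousCohomology 1 ((ρ.restrict (subgroupIncl (absInertia F))).toTopRep) →
      absInertia F → B := fun c x => (rep c).1 x - (ρ (x : absoluteGaloisGroup F) (b c) - b c)
  have hDdef : ∀ c x, D c x = (rep c).1 x - (ρ (x : absoluteGaloisGroup F) (b c) - b c) :=
    fun _ _ => rfl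
  have hDcoc : ∀ c x y, D c (x * y) = D c x + ρ (x : absoluteGaloisGroup F) (D c y) := fun c x y => by
    rw [hDdef, hDdef, hDdef, (rep c).2 x y]
    change (rep c).1 x + ρ (x : absoluteGaloisGroup F) ((rep c).1 y) - _ = _
    simp only [map_sub, Subgroup.coe_mul, map_mul, Module.End.mul_apply]
    abel
  have hDW : ∀ c (w : absInertia F), (w : absoluteGaloisGroup F) ∈ K → D c w = 0 := fun c w hw => by
    rw [hDdef, hb c w hw, sub_self]
  have hDg_mem : ∀ c, D c g ∈ BK := fun c w hw => by
    -- `w g = g (g⁻¹ w g)` with `g⁻¹ w g ∈ K ∩ I_F`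
    have h1 : D c (w * g) = ρ (w : absoluteGaloisGroup F) (D c g) := by
      rw [hDcoc, hDW c w hw, zero_add]
    have h2 : D c (w * g) = D c g := by
      have : w * g = g * (g⁻¹ * w * g) := by group
      rw [this, hDcoc, hDW c _ (hconjK w hw), map_zero, add_zero]
    rw [← h1, h2]
  -- the injection `[c] ↦ D c g  mod (g - 1) BK`
  let val : continuousCohomology 1 ((ρ.restrict (subgroupIncl (absInertia F))).toTopRep) →
      BK ⧸ T.range := fun c => QuotientAddGroup.mk ⟨D c g, hDg_mem c⟩
  have hinj : Injective val := by
    intro c d hcd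
    obtain ⟨x, hx⟩ : ∃ x : BK, ρ (g : absoluteGaloisGroup F) x - x = D c g - D d g := by
      have h := QuotientAddGroup.eq_iff_sub_mem.1 hcd
      obtain ⟨x, hx⟩ := AddMonoidHom.mem_range.1 h
      refine ⟨x, ?_⟩
      have := congrArg (fun y : BK => (y : B)) hx
      simpa [hT] using this
    -- `E = D c - D d - ∂x` is a crossed homomorphism vanishing on `W` and at `g`
    let E : absInertia F → B := fun y => D c y - D d y - (ρ (y : absoluteGaloisGroup F) x - x)
    have hEdef : ∀ y, E y = D c y - D d y - (ρ (y : absoluteGaloisGroup F) x - x) := fun _ => rfl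
    have hE : ∀ y z, E (y * z) = E y + ρ (y : absoluteGaloisGroup F) (E z) := fun y z => by
      rw [hEdef, hEdef, hEdef, hDcoc, hDcoc]
      simp only [map_sub, Subgroup.coe_mul, map_mul, Module.End.mul_apply]
      abel
    have hEW : ∀ w ∈ K.subgroupOf (absInertia F), E w = 0 := fun w hw => by
      rw [Subgroup.mem_subgroupOf] at hw
      rw [hEdef, hDW c w hw, hDW d w hw, (hBKmem x).1 x.2 w hw]; abel
    have hEg : E g = 0 := by rw [hEdef, hx]; abel
    have hgen' : ∀ y : absInertia F, ∃ k : ℕ, (g ^ k)⁻¹ * y ∈ K.subgroupOf (absInertia F) :=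
      fun y => by simpa only [Subgroup.mem_subgroupOf] using hgen y
    have hE0 := eq_zero_of_forall_mem_of_apply_eq_zero
      (fun (y : absInertia F) (v : B) => ρ (y : absoluteGaloisGroup F) v) (fun y => map_zero _)
      (K.subgroupOf (absInertia F)) g hgen' E hE hEW hEg
    -- hence `rep c - rep d` is the coboundary of `b c - b d + x`
    have hcls : oneCocycleClass _ (rep c - rep d) = 0 := by
      rw [oneCocycleClass_eq_zero_iff]
      refine ⟨b c - b d + (x : B), fun y => ?_⟩
      have h0 := hE0 y
      rw [hEdef, hDdef, hDdef] at h0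
      change (rep c).1 y - (rep d).1 y = ρ (y : absoluteGaloisGroup F) (b c - b d + (x : B)) -
        (b c - b d + (x : B))
      have h1 : (rep c).1 y - (rep d).1 y -
          (ρ (y : absoluteGaloisGroup F) (b c - b d + (x : B)) - (b c - b d + (x : B))) = 0 := by
        rw [← h0]
        simp only [map_sub, map_add]
        abel
      exact sub_eq_zero.1 h1
    rw [oneCocycleClass_sub, sub_eq_zero, hrep, hrep] at hcls
    exact hcls
  -- counting: `#(BK ⧸ range T) = #ker T = #B^{I_F}`
  haveI : Finite BK := inferInstance
  have hcount : Nat.card (BK ⧸ T.range) = Nat.card T.ker := by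
    have h1 := AddSubgroup.card_eq_card_quotient_mul_card_addSubgroup T.range
    have h2 := AddSubgroup.card_eq_card_quotient_mul_card_addSubgroup T.ker
    have h3 : Nat.card (BK ⧸ T.ker) = Nat.card T.range :=
      Nat.card_congr (QuotientAddGroup.quotientKerEquivRange T).toEquiv
    have hpos : 0 < Nat.card T.range := Nat.card_pos
    rw [h3, mul_comm] at h2
    exact Nat.eq_of_mul_eq_mul_right hpos (h1.symm.trans h2)
  have hker : Nat.card T.ker =
      Nat.card {x : B // ∀ σ : absoluteGaloisGroup F, σ ∈ absInertia F → ρ σ x = x} := by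
    refine Nat.card_congr ⟨fun x => ⟨((x : BK) : B), (hfix_iff _).2 ⟨x.1.2, ?_⟩⟩,
      fun x => ⟨⟨x.1, ((hfix_iff _).1 x.2).1⟩, ?_⟩, fun x => ?_, fun x => ?_⟩
    · have := x.2
      rw [AddMonoidHom.mem_ker] at this
      have h := congrArg (fun y : BK => (y : B)) this
      simpa [hT, sub_eq_zero] using h
    · rw [AddMonoidHom.mem_ker]
      exact Subtype.ext (by rw [hT]; exact sub_eq_zero.2 ((hfix_iff _).1 x.2).2)
    · rfl
    · rfl
  calc Nat.card (continuousCohomology 1 ((ρ.restrict (subgroupIncl (absInertia F))).toTopRep))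
      ≤ Nat.card (BK ⧸ T.range) := Nat.card_le_card_of_injective val hinj
    _ = _ := by rw [hcount, hker]

end Local

end Literature.NumberTheory.GaloisRepresentations

end
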